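import Mathlib
import Summits.CriticalPhenomena.PercolationContinuityZ3.Theses.PercNearOneGluingNoHeavy
import Summits.CriticalPhenomena.PercolationContinuityZ3.Theorems.PercNearOneGluingNoHeavyLowerTailTypedReductions
import Summits.CriticalPhenomena.PercolationContinuityZ3.Theorems.PercNearOneGluingAdditiveGluingOneBond
import Literature.Probability.LatticeModels.ProdBernoulliIndependence
import Literature.Probability.Percolation.PercolationEvents
import HarnessLib

/-!
# The pre-FKG shortening step implies Kozma–Nitzan's pre-FKG Conjecture 2 (form (3)), Conjecture 1 and the crux

Helper for crux `PercNearOneGluingNoHeavy.NoHeavyLowerTail` (item stmt-CriticalPhenomena-4575), lemma factory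
prim-lf-2 (deletion–contraction), 2026-08-19.

Setting: weights `w : Sym2 (Fin n) → [0,1]`, `μ_w = prodBernoulli w`, `P_w(x ↔ y) = μ_w(openConn x y)`,
`{o ↔ A} = ⋃ a ∈ A, openConn o a`.

THE KERNEL (hypothesis of `preShortening_induction`, displayed with its induction hypothesis exactly like the
registered kernels `stub_shorteningStep` / `stub_additiveShorteningStep` of the sibling lines): for `v ∉ A`, `v ≠ x`,
`w s(v,x) = 0`, a PRE-minimiser `a₀ ∈ A` of `a ↦ P_w(v ↔ A, a ↔ b)` and the pre-FKG inequality (3) known for every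
weight function supported inside the support of `w`, the inequality (3) holds at the GLUED source in `w[s(v,x) ↦ 1]`
against the OLD pre-minimiser:  `P₁(v ↔ A, a₀ ↔ b) ≤ P₁(v ↔ b, v ↔ A)`.  This is the pre-FKG analogue ("PRE6") of
Kozma–Nitzan's Conjecture 6 (arXiv:2401.12397 §5.3 p. 34); exact census (prim-lf-2 gen 6): 0 violations on all
connected supports with `n ≤ 6` (p = 1/2 and weighted) and random weighted `n = 7`.

THE POINT: both sides of (3) are probabilities of single events, hence AFFINE in the weight of one pair
(`stub_oneBondDecomp_k15`), so the one-bond induction needs NO concavity and no cross term: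
`Z = (1−p) Z₀ + p Z₁ ≤ (1−p) X₀ + p X₁ = X` from `Z₀ ≤ X₀` (induction, at the pre-minimiser of `w[e ↦ 0]`) and
`Z₁ ≤ X₁` (the kernel).  Consequences recorded here: Conjecture 2 (3) ⇒ additive Conjecture 1 (union bound) ⇒
`NoHeavyLowerTail` and `NearOneGluing` (landed sockets `noHeavyLowerTail_of_additiveConjecture1`,
`additiveGluing_of_additiveConjecture1`, `additiveGluingSuffices_proof`), and ⇒ Conjecture 1 (Harris).
No new definitions, no named facts, no sorries.
-/

namespace Summit.CriticalPhenomena.PercolationContinuityZ3.Theorems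

open MeasureTheory Set Literature.Probability.LatticeModels Literature.Probability.Percolation
open scoped Classical BigOperators

section PreShortening

variable {n : ℕ}

/-- The affine algebra of the pre-FKG one-bond induction: `Z₀ ≤ X₀`, `Z₁ ≤ X₁`, `0 ≤ p ≤ 1` and
`t ≤ (1−p)Z₀ + pZ₁` give `t ≤ (1−p)X₀ + pX₁`. [folklore] -/
theorem preLemma13_algebra {p X₀ X₁ Z₀ Z₁ t : ℝ} (hp0 : 0 ≤ p) (hp1 : p ≤ 1)
    (h0 : Z₀ ≤ X₀) (h1 : Z₁ ≤ X₁) (ht : t ≤ (1 - p) * Z₀ + p * Z₁) :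
    t ≤ (1 - p) * X₀ + p * X₁ := by
  have hq : 0 ≤ 1 - p := sub_nonneg.2 hp1
  have h4 : (1 - p) * Z₀ ≤ (1 - p) * X₀ := mul_le_mul_of_nonneg_left h0 hq
  have h5 : p * Z₁ ≤ p * X₁ := mul_le_mul_of_nonneg_left h1 hp0
  linarith

/-- If every pair at `o` has weight `0` and `o ∉ A`, then `P(o ↔ A, E) = 0` for every event `E`. [folklore] -/
theorem preLemma13_reach_inter_eq_zero (w : Sym2 (Fin n) → unitInterval) (A : Finset (Fin n)) {o : Fin n}
    (hoA : o ∉ A) (hiso : ∀ x : Fin n, x ≠ o → w s(o, x) = 0) (E : Set (BondConfig (Fin n))) :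
    (prodBernoulli w).real ((⋃ a ∈ A, openConn o a) ∩ E) = 0 :=
  le_antisymm ((measureReal_mono inter_subset_left (measure_ne_top _ _)).trans
    (addLemma13_reach_eq_zero w A hoA hiso).le) measureReal_nonneg

/-- **The pre-FKG shortening step (kernel "PRE6", with the induction hypothesis displayed) implies Kozma–Nitzan's
pre-FKG Conjecture 2 in the form (3)** (arXiv:2401.12397 p. 3: `P(0 ↔ b, 0 ↔ A) ≥ min_{a∈A} P(0 ↔ A, a ↔ b)`, here
min-free: `t ≤ P(o ↔ A, a ↔ b)` for all `a ∈ A ≠ ∅` gives `t ≤ P(o ↔ b, o ↔ A)`).  Strong induction on the number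
of positive pairs; if `o ∈ A` take `a := o`; if `o` has no positive pair both sides vanish; otherwise pick `x` with
`w s(o,x) ≠ 0`, let `a₀` minimise `P_{w[s(o,x)↦0]}(o ↔ A, · ↔ b)` on `A`, use induction at `w[s(o,x) ↦ 0]`, the kernel
at `w[s(o,x) ↦ 1]`, the one-bond decomposition (`stub_oneBondDecomp_k15`) and `preLemma13_algebra`.  The affine
twin of Kozma–Nitzan's Lemma 13 (p. 34). [folklore] -/
theorem preShortening_induction :
    (∀ (n : ℕ) (w : Sym2 (Fin n) → unitInterval) (A : Finset (Fin n)) (b v x a₀ : Fin n), v ∉ A → v ≠ x →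
      w s(v, x) = 0 → a₀ ∈ A →
      (∀ a ∈ A, (prodBernoulli w).real ((⋃ a' ∈ A, openConn v a') ∩ openConn a₀ b) ≤
        (prodBernoulli w).real ((⋃ a' ∈ A, openConn v a') ∩ openConn a b)) →
      (∀ w' : Sym2 (Fin n) → unitInterval, (∀ e, w e = 0 → w' e = 0) →
        ∀ (A' : Finset (Fin n)) (o' b' : Fin n) (t : ℝ), A'.Nonempty →
          (∀ a ∈ A', t ≤ (prodBernoulli w').real ((⋃ a' ∈ A', openConn o' a') ∩ openConn a b')) →
          t ≤ (prodBernoulli w').real (openConn o' b' ∩ ⋃ a' ∈ A', openConn o' a')) →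
      (prodBernoulli (Function.update w s(v, x) 1)).real ((⋃ a' ∈ A, openConn v a') ∩ openConn a₀ b) ≤
        (prodBernoulli (Function.update w s(v, x) 1)).real (openConn v b ∩ ⋃ a' ∈ A, openConn v a')) →
    ∀ (n : ℕ) (w : Sym2 (Fin n) → unitInterval) (A : Finset (Fin n)) (o b : Fin n) (t : ℝ), A.Nonempty →
      (∀ a ∈ A, t ≤ (prodBernoulli w).real ((⋃ a' ∈ A, openConn o a') ∩ openConn a b)) →
      t ≤ (prodBernoulli w).real (openConn o b ∩ ⋃ a' ∈ A, openConn o a') := by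
  intro hStep n
  -- strong induction on the number of positive pairs
  suffices H : ∀ k : ℕ, ∀ w : Sym2 (Fin n) → unitInterval,
      (Finset.univ.filter fun e => w e ≠ 0).card = k →
      ∀ (A : Finset (Fin n)) (o b : Fin n) (t : ℝ), A.Nonempty →
        (∀ a ∈ A, t ≤ (prodBernoulli w).real ((⋃ a' ∈ A, openConn o a') ∩ openConn a b)) →
        t ≤ (prodBernoulli w).real (openConn o b ∩ ⋃ a' ∈ A, openConn o a') by
    intro w A o b t hA ht
    exact H _ w rfl A o b t hA ht
  intro k
  induction k using Nat.strong_induction_on with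
  | _ k ih =>
  intro w hk A o b t hA ht
  -- case `o ∈ A`: take `a := o`; `{o ↔ A} ∩ {o ↔ b} = {o ↔ b} ∩ {o ↔ A}`
  by_cases hoA : o ∈ A
  · have hob := ht o hoA
    rwa [inter_comm] at hob
  -- case: every pair at `o` has weight `0`; then both sides vanish
  by_cases hiso : ∀ x : Fin n, x ≠ o → w s(o, x) = 0
  · obtain ⟨a, ha⟩ := hA
    have hta := ht a ha
    rw [preLemma13_reach_inter_eq_zero w A hoA hiso] at hta
    exact hta.trans measureReal_nonneg
  push Not at hiso
  obtain ⟨x, hxo, hwx⟩ := hiso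
  have hox : o ≠ x := fun h => hxo h.symm
  -- the two endpoint weight functions
  have hupd0 : Function.update w s(o, x) 0 s(o, x) = 0 := Function.update_self ..
  -- the support of `w[e ↦ 0]` is strictly smaller
  have hcard : (Finset.univ.filter fun e => Function.update w s(o, x) 0 e ≠ 0).card < k := by
    rw [← hk]
    refine Finset.card_lt_card ⟨?_, ?_⟩
    · intro e he
      simp only [Finset.mem_filter, Finset.mem_univ, true_and, Function.update_apply] at he ⊢
      split_ifs at he with h
      · exact absurd rfl he
      · exact he
    · intro hsub
      have := hsub (show s(o, x) ∈ Finset.univ.filter (fun e => w e ≠ 0) by simp [hwx])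
      simp at this
  -- induction hypothesis for every weight function supported inside the support of `w[e ↦ 0]`
  have hIH : ∀ w' : Sym2 (Fin n) → unitInterval, (∀ e, Function.update w s(o, x) 0 e = 0 → w' e = 0) →
      ∀ (A' : Finset (Fin n)) (o' b' : Fin n) (t' : ℝ), A'.Nonempty →
        (∀ a ∈ A', t' ≤ (prodBernoulli w').real ((⋃ a' ∈ A', openConn o' a') ∩ openConn a b')) →
        t' ≤ (prodBernoulli w').real (openConn o' b' ∩ ⋃ a' ∈ A', openConn o' a') := by
    intro w' hw' A' o' b' t' hA' ht'
    refine ih _ ?_ w' rfl A' o' b' t' hA' ht'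
    refine lt_of_le_of_lt (Finset.card_le_card ?_) hcard
    intro e he
    simp only [Finset.mem_filter, Finset.mem_univ, true_and] at he ⊢
    exact fun h0 => he (hw' e h0)
  -- the pre-minimiser `a₀` for `w[e ↦ 0]`
  obtain ⟨a₀, ha₀, hmin⟩ :=
    A.exists_min_image (fun a => (prodBernoulli (Function.update w s(o, x) 0)).real
      ((⋃ a' ∈ A, openConn o a') ∩ openConn a b)) hA
  -- the step at `w[e ↦ 0]`: (3) for `w[e ↦ 1]` against `a₀`
  have hstep := hStep n (Function.update w s(o, x) 0) A b o x a₀ hoA hox hupd0 ha₀ hmin hIH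
  simp only [Function.update_idem] at hstep
  -- induction at `w[e ↦ 0]` itself with `t := Z₀`
  have h0 := hIH (Function.update w s(o, x) 0) (fun e h => h) A o b
    ((prodBernoulli (Function.update w s(o, x) 0)).real ((⋃ a' ∈ A, openConn o a') ∩ openConn a₀ b)) hA hmin
  -- one-bond decompositions of `X = P(o ↔ b, o ↔ A)` and `Z = P(o ↔ A, a₀ ↔ b)`
  have hX := stub_oneBondDecomp_k15 n w s(o, x) (openConn o b ∩ ⋃ a' ∈ A, openConn o a')
  have hZ := stub_oneBondDecomp_k15 n w s(o, x) ((⋃ a' ∈ A, openConn o a') ∩ openConn a₀ b)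
  have hp0 : 0 ≤ (w s(o, x) : ℝ) := (w s(o, x)).2.1
  have hp1 : (w s(o, x) : ℝ) ≤ 1 := (w s(o, x)).2.2
  have ht' := ht a₀ ha₀
  rw [hZ] at ht'
  rw [hX]
  exact preLemma13_algebra hp0 hp1 h0 hstep ht'

/-- **Conjecture 2 in form (3) ⇒ additive Conjecture 1** (`P(o ↔ A) − (1 − t) ≤ P(o ↔ b)` when every relay has
`P(a ↔ b) ≥ t`, `A ≠ ∅`): at the pre-minimiser `a⋆`, `P(o ↔ A) + P(a⋆ ↔ b) − 1 ≤ P(o ↔ A, a⋆ ↔ b) ≤ P(o ↔ b, o ↔ A)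
≤ P(o ↔ b)` (union bound; no correlation inequality). [folklore] -/
theorem additiveConjecture1_of_conjecture2form :
    (∀ (n : ℕ) (w : Sym2 (Fin n) → unitInterval) (A : Finset (Fin n)) (o b : Fin n) (t : ℝ), A.Nonempty →
      (∀ a ∈ A, t ≤ (prodBernoulli w).real ((⋃ a' ∈ A, openConn o a') ∩ openConn a b)) →
      t ≤ (prodBernoulli w).real (openConn o b ∩ ⋃ a' ∈ A, openConn o a')) →
    ∀ (n : ℕ) (w : Sym2 (Fin n) → unitInterval) (A : Finset (Fin n)) (o b : Fin n) (t : ℝ), A.Nonempty →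
      (∀ a ∈ A, t ≤ (prodBernoulli w).real (openConn a b)) →
      (prodBernoulli w).real (⋃ a ∈ A, openConn o a) - (1 - t) ≤ (prodBernoulli w).real (openConn o b) := by
  intro hC2 n w A o b t hA ht
  set V : Set (BondConfig (Fin n)) := ⋃ a ∈ A, openConn o a with hV
  obtain ⟨a₀, ha₀, hmin⟩ := A.exists_min_image (fun a => (prodBernoulli w).real (V ∩ openConn a b)) hA
  have h2 := hC2 n w A o b ((prodBernoulli w).real (V ∩ openConn a₀ b)) hA hmin
  -- union bound: `P(V) ≤ P(V ∩ {a₀ ↔ b}) + P({a₀ ↔ b}ᶜ)` and `P({a₀ ↔ b}ᶜ) = 1 − P(a₀ ↔ b)`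
  have hmeas : ∀ S : Set (BondConfig (Fin n)), MeasurableSet S := fun S => MeasurableSet.of_discrete
  have hsub : V ⊆ (V ∩ openConn a₀ b) ∪ (openConn a₀ b)ᶜ := by
    intro ω hω
    by_cases h : ω ∈ openConn a₀ b
    · exact Or.inl ⟨hω, h⟩
    · exact Or.inr h
  have hub : (prodBernoulli w).real V ≤
      (prodBernoulli w).real (V ∩ openConn a₀ b) + (prodBernoulli w).real (openConn a₀ b)ᶜ :=
    (measureReal_mono hsub (measure_ne_top _ _)).trans (measureReal_union_le _ _)
  have hcompl : (prodBernoulli w).real (openConn a₀ b)ᶜ = 1 - (prodBernoulli w).real (openConn a₀ b) :=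
    probReal_compl_eq_one_sub (hmeas _)
  have hXb : (prodBernoulli w).real (openConn o b ∩ V) ≤ (prodBernoulli w).real (openConn o b) :=
    measureReal_mono inter_subset_left (measure_ne_top _ _)
  have hta := ht a₀ ha₀
  linarith

/-- **Conjecture 2 in form (3) ⇒ Conjecture 1** (Kozma–Nitzan arXiv:2401.12397 p. 3, "Conjecture 1 follows from
Conjecture 2 by an application of the FKG inequality"), min-free: `0 ≤ t ≤ P(a ↔ b)` on `A ≠ ∅` gives
`P(o ↔ A) · t ≤ P(o ↔ b)`.  Harris for the increasing events `{o ↔ A}`, `{a⋆ ↔ b}`. [cite: KozmaNitzan2024, p. 3] -/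
theorem conjecture1_of_conjecture2form :
    (∀ (n : ℕ) (w : Sym2 (Fin n) → unitInterval) (A : Finset (Fin n)) (o b : Fin n) (t : ℝ), A.Nonempty →
      (∀ a ∈ A, t ≤ (prodBernoulli w).real ((⋃ a' ∈ A, openConn o a') ∩ openConn a b)) →
      t ≤ (prodBernoulli w).real (openConn o b ∩ ⋃ a' ∈ A, openConn o a')) →
    ∀ (n : ℕ) (w : Sym2 (Fin n) → unitInterval) (A : Finset (Fin n)) (o b : Fin n) (t : ℝ), A.Nonempty →
      0 ≤ t → (∀ a ∈ A, t ≤ (prodBernoulli w).real (openConn a b)) →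
      (prodBernoulli w).real (⋃ a ∈ A, openConn o a) * t ≤ (prodBernoulli w).real (openConn o b) := by
  intro hC2 n w A o b t hA ht0 ht
  set V : Set (BondConfig (Fin n)) := ⋃ a ∈ A, openConn o a with hV
  obtain ⟨a₀, ha₀, hmin⟩ := A.exists_min_image (fun a => (prodBernoulli w).real (V ∩ openConn a b)) hA
  have h2 := hC2 n w A o b ((prodBernoulli w).real (V ∩ openConn a₀ b)) hA hmin
  have hmeas : ∀ S : Set (BondConfig (Fin n)), MeasurableSet S := fun S => MeasurableSet.of_discrete
  have hVup : IsUpperSet V := by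
    rw [hV]
    exact isUpperSet_iUnion₂ fun a _ => isUpperSet_openConn o a
  have hHarris : (prodBernoulli w).real V * (prodBernoulli w).real (openConn a₀ b) ≤
      (prodBernoulli w).real (V ∩ openConn a₀ b) :=
    prodBernoulli_harris w hVup (isUpperSet_openConn a₀ b) (hmeas _) (hmeas _)
  have hXb : (prodBernoulli w).real (openConn o b ∩ V) ≤ (prodBernoulli w).real (openConn o b) :=
    measureReal_mono inter_subset_left (measure_ne_top _ _)
  have hVt : (prodBernoulli w).real V * t ≤ (prodBernoulli w).real V * (prodBernoulli w).real (openConn a₀ b) :=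
    mul_le_mul_of_nonneg_left (ht a₀ ha₀) measureReal_nonneg
  linarith

/-- **The pre-FKG shortening step ⇒ `NoHeavyLowerTail`** (crux stmt-CriticalPhenomena-4575): kernel ⇒ Conjecture 2 (3)
(`preShortening_induction`) ⇒ additive Conjecture 1 ⇒ crux (`noHeavyLowerTail_of_additiveConjecture1`, landed). -/
theorem noHeavyLowerTail_of_preShorteningStep :
    (∀ (n : ℕ) (w : Sym2 (Fin n) → unitInterval) (A : Finset (Fin n)) (b v x a₀ : Fin n), v ∉ A → v ≠ x →
      w s(v, x) = 0 → a₀ ∈ A →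
      (∀ a ∈ A, (prodBernoulli w).real ((⋃ a' ∈ A, openConn v a') ∩ openConn a₀ b) ≤
        (prodBernoulli w).real ((⋃ a' ∈ A, openConn v a') ∩ openConn a b)) →
      (∀ w' : Sym2 (Fin n) → unitInterval, (∀ e, w e = 0 → w' e = 0) →
        ∀ (A' : Finset (Fin n)) (o' b' : Fin n) (t : ℝ), A'.Nonempty →
          (∀ a ∈ A', t ≤ (prodBernoulli w').real ((⋃ a' ∈ A', openConn o' a') ∩ openConn a b')) →
          t ≤ (prodBernoulli w').real (openConn o' b' ∩ ⋃ a' ∈ A', openConn o' a')) →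
      (prodBernoulli (Function.update w s(v, x) 1)).real ((⋃ a' ∈ A, openConn v a') ∩ openConn a₀ b) ≤
        (prodBernoulli (Function.update w s(v, x) 1)).real (openConn v b ∩ ⋃ a' ∈ A, openConn v a')) →
    Summit.CriticalPhenomena.PercolationContinuityZ3.Theses.PercNearOneGluingNoHeavy.NoHeavyLowerTail :=
  fun hstep => noHeavyLowerTail_of_additiveConjecture1
    (additiveConjecture1_of_conjecture2form (preShortening_induction hstep))

/-- **Conjecture 1 (min-free form) ⇒ `NearOneGluing`** (= Kozma–Nitzan Conjecture 3; arXiv:2401.12397 p. 15: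
"Conjecture 3 clearly follows from conjecture 1"), with `δ := ε/2`: `P(o ↔ b) ≥ P(o ↔ A)(1 − δ) > (1 − δ)² ≥ 1 − ε`.
[cite: KozmaNitzan2024, p. 15] -/
theorem nearOneGluing_of_conjecture1form :
    (∀ (n : ℕ) (w : Sym2 (Fin n) → unitInterval) (A : Finset (Fin n)) (o b : Fin n) (t : ℝ), A.Nonempty →
      0 ≤ t → (∀ a ∈ A, t ≤ (prodBernoulli w).real (openConn a b)) →
      (prodBernoulli w).real (⋃ a ∈ A, openConn o a) * t ≤ (prodBernoulli w).real (openConn o b)) →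
    Summit.CriticalPhenomena.PercolationContinuityZ3.Theses.PercNearOneGluingNoHeavy.NearOneGluing := by
  intro hC1 ε hε
  refine ⟨ε / 2, by positivity, ?_⟩
  intro n w A o b hoA hA
  have hX0 : 0 ≤ (prodBernoulli w).real (openConn o b) := measureReal_nonneg
  by_cases hε2 : ε < 2
  · have ht0 : 0 < 1 - ε / 2 := by linarith
    rcases A.eq_empty_or_nonempty with hAe | hAne
    · subst hAe
      simp only [Finset.notMem_empty, Set.iUnion_of_empty, Set.iUnion_empty, measureReal_empty] at hoA
      linarith
    · have key := hC1 n w A o b (1 - ε / 2) hAne ht0.le (fun a ha => (hA a ha).le)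
      have hmul : (1 - ε / 2) * (1 - ε / 2) <
          (prodBernoulli w).real (⋃ a ∈ A, openConn o a) * (1 - ε / 2) :=
        mul_lt_mul_of_pos_right hoA ht0
      nlinarith
  · push Not at hε2
    linarith

/-- **The pre-FKG shortening step ⇒ `NearOneGluing`** (= Kozma–Nitzan Conjecture 3, crux stmt-CriticalPhenomena-4574):
kernel ⇒ Conjecture 2 (3) (`preShortening_induction`) ⇒ Conjecture 1 (`conjecture1_of_conjecture2form`) ⇒
Conjecture 3 (`nearOneGluing_of_conjecture1form`). -/
theorem nearOneGluing_of_preShorteningStep :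
    (∀ (n : ℕ) (w : Sym2 (Fin n) → unitInterval) (A : Finset (Fin n)) (b v x a₀ : Fin n), v ∉ A → v ≠ x →
      w s(v, x) = 0 → a₀ ∈ A →
      (∀ a ∈ A, (prodBernoulli w).real ((⋃ a' ∈ A, openConn v a') ∩ openConn a₀ b) ≤
        (prodBernoulli w).real ((⋃ a' ∈ A, openConn v a') ∩ openConn a b)) →
      (∀ w' : Sym2 (Fin n) → unitInterval, (∀ e, w e = 0 → w' e = 0) →
        ∀ (A' : Finset (Fin n)) (o' b' : Fin n) (t : ℝ), A'.Nonempty →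
          (∀ a ∈ A', t ≤ (prodBernoulli w').real ((⋃ a' ∈ A', openConn o' a') ∩ openConn a b')) →
          t ≤ (prodBernoulli w').real (openConn o' b' ∩ ⋃ a' ∈ A', openConn o' a')) →
      (prodBernoulli (Function.update w s(v, x) 1)).real ((⋃ a' ∈ A, openConn v a') ∩ openConn a₀ b) ≤
        (prodBernoulli (Function.update w s(v, x) 1)).real (openConn v b ∩ ⋃ a' ∈ A, openConn v a')) →
    Summit.CriticalPhenomena.PercolationContinuityZ3.Theses.PercNearOneGluingNoHeavy.NearOneGluing :=
  fun hstep => nearOneGluing_of_conjecture1form (conjecture1_of_conjecture2form (preShortening_induction hstep))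

end PreShortening

end Summit.CriticalPhenomena.PercolationContinuityZ3.Theorems
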